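import Summits.NavierStokesRegularity.NavierStokesRegularity.Theorems.StrainDoorsViscous
import Summits.NavierStokesRegularity.NavierStokesRegularity.Theorems.StrainDoors
import HarnessLib

/-!
# StrainDoorsViscousCompositions — doors S37-H⁺ «StrainFeedingViscousDoor» / S37-Π⁺ «PressureFocusingViscousDoor» from the
# plates, edges H⁺ → H / Π⁺ → Π, and the CLOSERS (§6⁺–§9⁺ of nsreg-p1 g31's `r35/Sketch37c.lean` sha16 a97e15abb2eed89a,
# l.212–549 VERBATIM; the primed alias `gradientUniformDecay_holds'` replaced by the tree's `gradientUniformDecay_holds`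
# (`Theorems/StrainDoors.lean`, p660522) and the two trailing `example`s dropped, per the planner's landing cut)

`strainDoor_of_growth` (the two-slab barrier factored), `strainFeedingViscousDoor_of : StrainGrowthViscous → StrainFrame →
StrainThreshold → SubcriticalStrainDoor → StrainFeedingViscousDoor`, `pressureFocusingViscousDoor_of : PoissonTrace → H⁺ → Π⁺`,
`strainLap_nonpos_of_isStrainArgmax`, edges `strainFeedingDoor_of_viscousDoor` / `pressureFocusingDoor_of_viscousDoor`,
`…_of_decay : GradientUniformDecay → …`, and **`strainFeedingViscousDoor_holds` / `pressureFocusingViscousDoor_holds`** — doors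
H⁺/Π⁺ CLOSED, UNCONDITIONAL.  Landed by ns-s29-p2 g4 under LEAD ns-s30-p1 g3, `--supports stmt-NavierStokesRegularity-0056 --as helper`.

HONEST FRAME: threshold CRITERIA about a hypothetical blow-up («a first blow-up must feed its top strain eigenvalue at the
critical rate net of viscous flattening»); item 0056 `NoTypeII` and NS regularity are NOT proved.
-/

noncomputable section

open MeasureTheory Set Function Filter Metric Real InnerProductSpace
open _root_.Topology
open scoped ENNReal NNReal RealInnerProductSpace ContDiff Laplacian
open Literature.Analysis Literature.Analysis.FluidPDE
open Literature.Analysis.FluidPDE.VorticityDirectionDynamics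

set_option linter.dupNamespace false

namespace Summit.NavierStokesRegularity.NavierStokesRegularity.Theorems.StrainDoors

open Summit.NavierStokesRegularity.NavierStokesRegularity.Theorems.ArgmaxDoors

-- nested operator types (second derivatives)
set_option maxSynthPendingDepth 3
/-! ## §6⁺ The two-slab barrier factored, and door H⁺ from the plates -/

/-- support (the BARRIER CORE of `strainFeedingDoor_of`, Steps 1–5 verbatim): in the frame, if at every charged strain
argmax (`t ∈ [t₀,T)`, `(T − t)⟪∇u ē,ē⟫ > y₀`) the Riccati inequality `∂ₜ⟪∇u ē,ē⟫ ≤ −⟪∇u ē,ē⟫² + c/(T−t)²` holds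
(`0 ≤ c < y₀(1+y₀)`), then E2_S (`StrainThreshold`) propagates the log barrier and then `y₀/(T−t)`, and door Λ
(`SubcriticalStrainDoor`) continues `u` past `T`. Every S37 door (H, H⁺, and any future charge producing the same
Riccati inequality) is this core plus its own Step 0. [folklore] -/
theorem strainDoor_of_growth (hTh : StrainThreshold) (hΛ : SubcriticalStrainDoor)
    {ν T t₀ y₀ c : ℝ} (hν : 0 < ν) (ht₀ : 0 ≤ t₀) (ht₀T : t₀ < T) (hy₀ : 0 < y₀) (hy₀1 : y₀ < 1)
    (hc : c < y₀ * (1 + y₀)) (hc0 : 0 ≤ c)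
    {u : ℝ → (EuclideanSpace ℝ (Fin 3)) → (EuclideanSpace ℝ (Fin 3))} {p : ℝ → (EuclideanSpace ℝ (Fin 3)) → ℝ}
    (hsol : IsClassicalNSSolutionOn (Ico 0 T) ν 0 u p)
    (hreg : ∀ T'' < T, HasBoundedSobolevNormsOn (Icc 0 T'') u)
    (hgrowth : ∀ t ∈ Ico t₀ T, ∀ (x e : EuclideanSpace ℝ (Fin 3)), IsStrainArgmax u t x e →
      y₀ < (T - t) * strainQuad u t x e →
      strainRate T u t x e ≤ -(strainQuad u t x e) ^ 2 + c / (T - t) ^ 2) :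
    HasSobolevExtensionPast ν u T := by
  have hT : 0 < T := lt_of_le_of_lt ht₀ ht₀T
  have hTt₀ : 0 < T - t₀ := sub_pos.2 ht₀T
  -- ### Step 1: a bound for the strain form at time `t₀`
  obtain ⟨M, hM0, hM⟩ : ∃ M : ℝ, 0 ≤ M ∧
      ∀ (x e : EuclideanSpace ℝ (Fin 3)), ‖e‖ = 1 → strainQuad u t₀ x e ≤ M := by
    set T'' : ℝ := (t₀ + T) / 2 with hT''
    have hT''T : T'' < T := by rw [hT'']; linarith
    have ht₀T'' : t₀ ≤ T'' := by rw [hT'']; linarith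
    have hT''0 : 0 < T'' := by rw [hT'']; linarith
    have hS : IsClassicalNSSolutionOn (Icc 0 T'') ν 0 u p :=
      hsol.mono (Icc_subset_Ico_right hT''T) (uniqueDiffOn_Icc hT''0)
    have hBn : HasBoundedSobolevNormsOn (Icc 0 T'') u := hreg T'' hT''T
    obtain ⟨B₁, B₂, hB₁, -, hpk⟩ := IntenseSetDoors.slice_package hS hBn
    refine ⟨B₁, hB₁, fun x e he => ?_⟩
    obtain ⟨-, -, -, -, -, hgrad, -⟩ := hpk t₀ ⟨ht₀, ht₀T''⟩
    calc strainQuad u t₀ x e ≤ ‖fderiv ℝ (u t₀) x e‖ * ‖e‖ := real_inner_le_norm _ _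
      _ ≤ ‖fderiv ℝ (u t₀) x‖ * ‖e‖ * ‖e‖ := by
          gcongr
          exact ContinuousLinearMap.le_opNorm _ _
      _ ≤ B₁ := by rw [he, mul_one, mul_one]; exact hgrad x
  -- ### Step 2: constants of the two-slab barrier
  have hgap : 0 < y₀ ^ 2 + y₀ - c := by nlinarith [hc]
  set κ : ℝ := (y₀ ^ 2 + y₀ - c) / 2 with hκ
  have hκ0 : 0 < κ := by rw [hκ]; linarith [hgap]
  set Y : ℝ := y₀ + (T - t₀) * M + 1 with hY
  have hYy₀ : y₀ < Y := by have := mul_nonneg hTt₀.le hM0; rw [hY]; linarith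
  have hY0 : 0 < Y := hy₀.trans hYy₀
  -- the Riccati margin: `c + κ ≤ y + y²` for `y ≥ y₀`
  have hquad : ∀ y : ℝ, y₀ ≤ y → c + κ ≤ y + y ^ 2 := by
    intro y hy
    have h1 : c + κ ≤ y₀ + y₀ ^ 2 := by rw [hκ]; nlinarith [hc]
    have h2 : 0 ≤ (y - y₀) * (y + y₀ + 1) := mul_nonneg (sub_nonneg.2 hy) (by linarith)
    nlinarith
  -- `ρ = e^{−(Y − y₀)/κ} ∈ (0,1)`, `τ = T − (T − t₀)ρ`
  set ρ : ℝ := Real.exp (-((Y - y₀) / κ)) with hρ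
  have hρ0 : 0 < ρ := Real.exp_pos _
  have hρ1 : ρ < 1 := by
    have h : Real.exp (-((Y - y₀) / κ)) < Real.exp 0 :=
      Real.exp_lt_exp.2 (by have := div_pos (sub_pos.2 hYy₀) hκ0; linarith)
    rwa [Real.exp_zero] at h
  have hlogρ : Real.log ρ = -((Y - y₀) / κ) := by rw [hρ, Real.log_exp]
  set τ : ℝ := T - (T - t₀) * ρ with hτ
  have hTτ : T - τ = (T - t₀) * ρ := by rw [hτ]; ring
  have hTτ0 : 0 < T - τ := by rw [hTτ]; exact mul_pos hTt₀ hρ0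
  have ht₀τ : t₀ < τ := by
    have : (T - t₀) * ρ < (T - t₀) * 1 := mul_lt_mul_of_pos_left hρ1 hTt₀
    rw [hτ]; linarith
  have hτT : τ < T := by linarith
  have hτ0 : 0 ≤ τ := ht₀.trans ht₀τ.le
  -- ### Step 3: slab 1, `[t₀, τ]`, barrier `B₁ = (C₀ + κ log (T − t)) / (T − t)`
  set C₀ : ℝ := Y - κ * Real.log (T - t₀) with hC₀
  set Bf : ℝ → ℝ := fun t => (C₀ + κ * Real.log (T - t)) / (T - t) with hBf
  set Bf' : ℝ → ℝ := fun t => (C₀ + κ * Real.log (T - t) - κ) / (T - t) ^ 2 with hBf'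
  set hf : ℝ → ℝ := fun t => c / (T - t) ^ 2 with hhf
  -- the numerator `y(t) = C₀ + κ log (T − t)` stays `≥ y₀` on `[t₀, τ]` and equals `y₀` at `τ`
  have hyτ : C₀ + κ * Real.log (T - τ) = y₀ := by
    rw [hTτ, Real.log_mul hTt₀.ne' hρ0.ne', hlogρ, hC₀, mul_add, mul_neg, mul_div_cancel₀ _ hκ0.ne']
    ring
  have hyge : ∀ t ∈ Icc t₀ τ, y₀ ≤ C₀ + κ * Real.log (T - t) := by
    intro t ht
    have hTt : 0 < T - t := by linarith [ht.2]
    have hlog : Real.log (T - τ) ≤ Real.log (T - t) := Real.log_le_log hTτ0 (by linarith [ht.2])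
    have := mul_le_mul_of_nonneg_left hlog hκ0.le
    linarith [hyτ]
  have hslab1 : ∀ t ∈ Icc t₀ τ, ∀ (x e : EuclideanSpace ℝ (Fin 3)), ‖e‖ = 1 →
      strainQuad u t x e ≤ Bf t := by
    have hBc : ContinuousOn Bf (Icc t₀ τ) := by
      have h1 : ContinuousOn (fun t : ℝ => T - t) (Icc t₀ τ) := continuousOn_const.sub continuousOn_id
      have hne : ∀ t ∈ Icc t₀ τ, T - t ≠ 0 := fun t ht => by
        have : t ≤ τ := ht.2; exact (show (0:ℝ) < T - t by linarith).ne'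
      have h2 : ContinuousOn (fun t : ℝ => C₀ + κ * Real.log (T - t)) (Icc t₀ τ) :=
        continuousOn_const.add (continuousOn_const.mul (h1.log hne))
      exact h2.div h1 hne
    have hBpos : ∀ t ∈ Icc t₀ τ, 0 < Bf t := by
      intro t ht
      have hTt : 0 < T - t := by linarith [ht.2]
      exact div_pos (hy₀.trans_le (hyge t ht)) hTt
    have hBd : ∀ t ∈ Icc t₀ τ, HasDerivWithinAt Bf (Bf' t) (Icc t₀ τ) t := by
      intro t ht
      have hTt : 0 < T - t := by linarith [ht.2]
      have hlin : HasDerivAt (fun r : ℝ => T - r) (-1) t := by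
        simpa using (hasDerivAt_id t).const_sub T
      have hlog : HasDerivAt (fun r : ℝ => Real.log (T - r)) ((-1) / (T - t)) t := hlin.log hTt.ne'
      have hnum : HasDerivAt (fun r : ℝ => C₀ + κ * Real.log (T - r)) (0 + κ * ((-1) / (T - t))) t :=
        (hasDerivAt_const t C₀).add (hlog.const_mul κ)
      have hquot := hnum.div hlin hTt.ne'
      have hTt' : T - t ≠ 0 := hTt.ne'
      refine (hquot.congr_deriv ?_).hasDerivWithinAt
      simp only [hBf']
      field_simp
      ring
    have hsuper : ∀ t ∈ Icc t₀ τ, -(Bf t) ^ 2 + hf t ≤ Bf' t := by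
      intro t ht
      have hTt : 0 < T - t := by linarith [ht.2]
      have hy := hquad _ (hyge t ht)
      simp only [hBf, hBf', hhf]
      rw [div_pow]
      have h1 : -((C₀ + κ * Real.log (T - t)) ^ 2 / (T - t) ^ 2) + c / (T - t) ^ 2 =
          (c - (C₀ + κ * Real.log (T - t)) ^ 2) / (T - t) ^ 2 := by ring
      rw [h1, div_le_div_iff_of_pos_right (by positivity)]
      linarith [hy]
    have hrate : ∀ t ∈ Ioc t₀ τ, ∀ (x e : EuclideanSpace ℝ (Fin 3)), IsStrainArgmax u t x e →
        Bf t < strainQuad u t x e → strainRate T u t x e ≤ -(strainQuad u t x e) ^ 2 + hf t := by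
      intro t ht x e hax hbig
      have hTt : 0 < T - t := by linarith [ht.2]
      have htI : t ∈ Ico t₀ T := ⟨ht.1.le, by linarith [ht.2]⟩
      have hy := hyge t ⟨ht.1.le, ht.2⟩
      have hline : y₀ < (T - t) * strainQuad u t x e := by
        have h1 : (T - t) * Bf t = C₀ + κ * Real.log (T - t) := by
          simp only [hBf]; rw [mul_div_cancel₀ _ hTt.ne']
        have h2 : (T - t) * Bf t < (T - t) * strainQuad u t x e := mul_lt_mul_of_pos_left hbig hTt
        linarith
      exact hgrowth t htI x e hax hline
    have hinit : ∀ (x e : EuclideanSpace ℝ (Fin 3)), ‖e‖ = 1 → strainQuad u t₀ x e ≤ Bf t₀ := by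
      intro x e he
      have h1 : Bf t₀ = Y / (T - t₀) := by simp only [hBf, hC₀]; ring
      rw [h1, le_div_iff₀ hTt₀]
      have h2 := hM x e he
      have h3 : strainQuad u t₀ x e * (T - t₀) ≤ M * (T - t₀) := mul_le_mul_of_nonneg_right h2 hTt₀.le
      rw [hY]; nlinarith
    exact hTh ν T t₀ τ hν ht₀ ht₀τ hτT u p hsol hreg Bf Bf' hf hBc hBpos hBd hsuper
      (fun t _ => div_nonneg hc0 (sq_nonneg _)) hrate hinit
  -- the value at `τ`: `⟪∇u(τ,x)e,e⟫ ≤ y₀ / (T − τ)`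
  have hatτ : ∀ (x e : EuclideanSpace ℝ (Fin 3)), ‖e‖ = 1 → strainQuad u τ x e ≤ y₀ / (T - τ) := by
    intro x e he
    have h := hslab1 τ ⟨ht₀τ.le, le_rfl⟩ x e he
    simp only [hBf] at h
    rwa [hyτ] at h
  -- ### Step 4: slab 2, `[τ, t₂]` for every `t₂ < T`, barrier `B₂ = y₀ / (T − t)`
  have hslab2 : ∀ t ∈ Ico τ T, ∀ (x e : EuclideanSpace ℝ (Fin 3)), ‖e‖ = 1 →
      (T - t) * strainQuad u t x e ≤ y₀ := by
    intro t ht x e he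
    set t₂ : ℝ := (t + T) / 2 with ht₂
    have hτt₂ : τ < t₂ := by rw [ht₂]; linarith [ht.1, ht.2]
    have ht₂T : t₂ < T := by rw [ht₂]; linarith [ht.2]
    have htt₂ : t ≤ t₂ := by rw [ht₂]; linarith [ht.2]
    set B₂ : ℝ → ℝ := fun s => y₀ / (T - s) with hB₂
    set B₂' : ℝ → ℝ := fun s => y₀ / (T - s) ^ 2 with hB₂'
    set h₂ : ℝ → ℝ := fun s => c / (T - s) ^ 2 with hh₂
    have hpos : ∀ s ∈ Icc τ t₂, 0 < T - s := fun s hs => by linarith [hs.2]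
    have hBc : ContinuousOn B₂ (Icc τ t₂) :=
      continuousOn_const.div (continuousOn_const.sub continuousOn_id) fun s hs => (hpos s hs).ne'
    have hBpos : ∀ s ∈ Icc τ t₂, 0 < B₂ s := fun s hs => div_pos hy₀ (hpos s hs)
    have hBd : ∀ s ∈ Icc τ t₂, HasDerivWithinAt B₂ (B₂' s) (Icc τ t₂) s := by
      intro s hs
      have hTs := hpos s hs
      have hlin : HasDerivAt (fun r : ℝ => T - r) (-1) s := by
        simpa using (hasDerivAt_id s).const_sub T
      have hquot := (hasDerivAt_const s y₀).div hlin hTs.ne'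
      have hTs' : T - s ≠ 0 := hTs.ne'
      refine (hquot.congr_deriv ?_).hasDerivWithinAt
      simp only [hB₂']
      field_simp
      ring
    have hsuper : ∀ s ∈ Icc τ t₂, -(B₂ s) ^ 2 + h₂ s ≤ B₂' s := by
      intro s hs
      have hTs := hpos s hs
      simp only [hB₂, hB₂', hh₂]
      rw [div_pow]
      have hc' : c ≤ y₀ + y₀ ^ 2 := by nlinarith
      have h1 : -(y₀ ^ 2 / (T - s) ^ 2) + c / (T - s) ^ 2 = (c - y₀ ^ 2) / (T - s) ^ 2 := by ring
      rw [h1, div_le_div_iff_of_pos_right (by positivity)]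
      linarith
    have hrate : ∀ s ∈ Ioc τ t₂, ∀ (x e : EuclideanSpace ℝ (Fin 3)), IsStrainArgmax u s x e →
        B₂ s < strainQuad u s x e → strainRate T u s x e ≤ -(strainQuad u s x e) ^ 2 + h₂ s := by
      intro s hs x' e' hax hbig
      have hTs : 0 < T - s := by linarith [hs.2]
      have hsI : s ∈ Ico t₀ T := ⟨(ht₀τ.trans hs.1).le, by linarith [hs.2]⟩
      have hline : y₀ < (T - s) * strainQuad u s x' e' := by
        have h1 : (T - s) * B₂ s = y₀ := by simp only [hB₂]; rw [mul_div_cancel₀ _ hTs.ne']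
        have h2 : (T - s) * B₂ s < (T - s) * strainQuad u s x' e' := mul_lt_mul_of_pos_left hbig hTs
        linarith
      exact hgrowth s hsI x' e' hax hline
    have hinit : ∀ (x e : EuclideanSpace ℝ (Fin 3)), ‖e‖ = 1 → strainQuad u τ x e ≤ B₂ τ := by
      intro x' e' he'
      simp only [hB₂]
      exact hatτ x' e' he'
    have hmain := hTh ν T τ t₂ hν hτ0 hτt₂ ht₂T u p hsol hreg B₂ B₂' h₂ hBc hBpos hBd hsuper
      (fun s _ => div_nonneg hc0 (sq_nonneg _)) hrate hinit
    have h := hmain t ⟨ht.1, htt₂⟩ x e he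
    have hTt : 0 < T - t := sub_pos.2 ht.2
    simp only [hB₂] at h
    rw [le_div_iff₀ hTt] at h
    linarith
  -- ### Step 5: door Λ on `[τ, T)`
  exact hΛ ν T τ y₀ hν hτ0 hτT hy₀1 u p hsol hreg hslab2

/-- **Door S37-H⁺ from the plates**: `StrainGrowthViscous → StrainFrame → StrainThreshold → SubcriticalStrainDoor →
StrainFeedingViscousDoor`. Step 0⁺: at a charged argmax, Fermat (`IsLocalMax.fderiv_eq_zero`) makes `x̄` a critical
point, E1_S⁺ + F_S give `∂ₜ⟪∇u ē,ē⟫ ≤ −⟪∇u ē,ē⟫² + H + ν·Δ_x⟪∇u ē,ē⟫`, and the door hypothesis bounds the last two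
terms by `c/(T−t)²`; then the core. [folklore] -/
theorem strainFeedingViscousDoor_of (hG : StrainGrowthViscous) (hFr : StrainFrame) (hTh : StrainThreshold)
    (hΛ : SubcriticalStrainDoor) : StrainFeedingViscousDoor := by
  intro ν T t₀ y₀ c hν ht₀ ht₀T hy₀ hy₀1 hc u p hsol hreg hhyp
  -- WLOG `0 ≤ c`
  wlog hc0 : 0 ≤ c generalizing c with Hwlog
  · exact Hwlog (max c 0) (max_lt hc (by positivity))
      (fun t ht x e hax hbig => (hhyp t ht x e hax hbig).trans (le_max_left _ _)) (le_max_right _ _)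
  have hT : 0 < T := lt_of_le_of_lt ht₀ ht₀T
  refine strainDoor_of_growth hTh hΛ hν ht₀ ht₀T hy₀ hy₀1 hc hc0 hsol hreg fun t ht x e hax hbig => ?_
  -- ### Step 0⁺: the Riccati inequality with the viscous credit at a charged strain argmax
  have ht' : t ∈ Ico 0 T := ⟨ht₀.trans ht.1, ht.2⟩
  have hTt : 0 < T - t := sub_pos.2 ht.2
  have hsm : ContDiff ℝ ∞ (u t) := hsol.smooth_velocity.contDiff_slice ht'
  have heq := hFr ν T hν hT u p hsol t ht' x e
  have hloc : IsLocalMax (fun y => strainQuad u t y e) x :=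
    Filter.Eventually.of_forall fun y => hax.2 y e hax.1
  have hcrit : fderiv ℝ (fun y => ⟪fderiv ℝ (u t) y e, e⟫) x = 0 := hloc.fderiv_eq_zero
  have hE := hG ν (u t) (p t) hsm x e hax.1 hcrit _ heq
  have hfeed := hhyp t ht x e hax hbig
  have hfeed' : strainFeed u p t x e + ν * strainLap u t x e ≤ c / (T - t) ^ 2 := by
    rw [le_div_iff₀ (by positivity)]
    linarith [hfeed]
  have h1 : strainRate T u t x e ≤
      -(strainQuad u t x e) ^ 2 + (strainFeed u p t x e + ν * strainLap u t x e) := by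
    unfold strainRate strainLap strainFeed pressureHess strainQuad
    linarith [hE]
  linarith

/-! ## §7⁺ Door S37-Π⁺ from door S37-H⁺ and the Poisson equation -/

/-- **Door S37-Π⁺ from door S37-H⁺**: `PoissonTrace → StrainFeedingViscousDoor → PressureFocusingViscousDoor` (the
identity of `pressureFocusingDoor_of`, the viscous credit carried along). [folklore] -/
theorem pressureFocusingViscousDoor_of (hP : PoissonTrace) (hH : StrainFeedingViscousDoor) :
    PressureFocusingViscousDoor := by
  intro ν T t₀ y₀ c hν ht₀ ht₀T hy₀ hy₀1 hc u p hsol hreg hhyp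
  have hT : 0 < T := lt_of_le_of_lt ht₀ ht₀T
  set t₁ : ℝ := (t₀ + T) / 2 with ht₁
  have ht₁0 : 0 < t₁ := by rw [ht₁]; linarith
  have ht₀t₁ : t₀ ≤ t₁ := by rw [ht₁]; linarith
  have ht₁T : t₁ < T := by rw [ht₁]; linarith
  refine hH ν T t₁ y₀ c hν ht₁0.le ht₁T hy₀ hy₀1 hc u p hsol hreg ?_
  intro t ht x e hax hbig
  have hPt := hP ν T hν hT u p hsol t ⟨ht₁0.trans_le ht.1, ht.2⟩ x
  have h := hhyp t ⟨ht₀t₁.trans ht.1, ht.2⟩ x e hax hbig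
  have hid : strainFeed u p t x e = (1 / 3) * strainNormSq u t x + (1 / 12) * ‖curl (u t) x‖ ^ 2 -
      (1 / 4) * ⟪curl (u t) x, e⟫ ^ 2 - devPressureHess p t x e := by
    rw [devPressureHess_eq p t x hax.1]
    unfold strainFeed strainNormSq pressureHess
    rw [hPt]
    ring
  rw [hid]
  exact h

/-! ## §8⁺ Edges and closers -/

/-- at a strain argmax the kept term is a credit: `strainLap u t x̄ ē ≤ 0`. -/
theorem strainLap_nonpos_of_isStrainArgmax {u : ℝ → (EuclideanSpace ℝ (Fin 3)) → (EuclideanSpace ℝ (Fin 3))}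
    {t : ℝ} (hsm : ContDiff ℝ ∞ (u t)) {x e : EuclideanSpace ℝ (Fin 3)} (hax : IsStrainArgmax u t x e) :
    strainLap u t x e ≤ 0 := by
  have h1 := inner_fderiv_laplacian_le_zero_of_isMax hsm x e (fun y => hax.2 y e hax.1)
  rw [inner_fderiv_laplacian_eq_laplacian_strain hsm x e] at h1
  exact h1

/-- **H⁺ ⇒ H** (the viscous door is the stronger criterion: door H's hypothesis implies door H⁺'s). -/
theorem strainFeedingDoor_of_viscousDoor (hV : StrainFeedingViscousDoor) : StrainFeedingDoor := by
  intro ν T t₀ y₀ c hν ht₀ ht₀T hy₀ hy₀1 hc u p hsol hreg hhyp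
  refine hV ν T t₀ y₀ c hν ht₀ ht₀T hy₀ hy₀1 hc u p hsol hreg ?_
  intro t ht x e hax hbig
  have ht' : t ∈ Ico 0 T := ⟨ht₀.trans ht.1, ht.2⟩
  have hsm : ContDiff ℝ ∞ (u t) := hsol.smooth_velocity.contDiff_slice ht'
  have hlap : strainLap u t x e ≤ 0 := strainLap_nonpos_of_isStrainArgmax hsm hax
  have h := hhyp t ht x e hax hbig
  have hνlap : (T - t) ^ 2 * (ν * strainLap u t x e) ≤ 0 :=
    mul_nonpos_of_nonneg_of_nonpos (sq_nonneg _) (mul_nonpos_of_nonneg_of_nonpos hν.le hlap)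
  have hsplit : (T - t) ^ 2 * (strainFeed u p t x e + ν * strainLap u t x e) =
      (T - t) ^ 2 * strainFeed u p t x e + (T - t) ^ 2 * (ν * strainLap u t x e) := by ring
  linarith

/-- **Π⁺ ⇒ Π**. -/
theorem pressureFocusingDoor_of_viscousDoor (hV : PressureFocusingViscousDoor) : PressureFocusingDoor := by
  intro ν T t₀ y₀ c hν ht₀ ht₀T hy₀ hy₀1 hc u p hsol hreg hhyp
  refine hV ν T t₀ y₀ c hν ht₀ ht₀T hy₀ hy₀1 hc u p hsol hreg ?_
  intro t ht x e hax hbig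
  have ht' : t ∈ Ico 0 T := ⟨ht₀.trans ht.1, ht.2⟩
  have hsm : ContDiff ℝ ∞ (u t) := hsol.smooth_velocity.contDiff_slice ht'
  have hlap : strainLap u t x e ≤ 0 := strainLap_nonpos_of_isStrainArgmax hsm hax
  have h := hhyp t ht x e hax hbig
  have hνlap : (T - t) ^ 2 * (ν * strainLap u t x e) ≤ 0 :=
    mul_nonpos_of_nonneg_of_nonpos (sq_nonneg _) (mul_nonpos_of_nonneg_of_nonpos hν.le hlap)
  have hsplit : (T - t) ^ 2 * ((1 / 3) * strainNormSq u t x + (1 / 12) * ‖curl (u t) x‖ ^ 2 -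
        (1 / 4) * ⟪curl (u t) x, e⟫ ^ 2 - devPressureHess p t x e + ν * strainLap u t x e) =
      (T - t) ^ 2 * ((1 / 3) * strainNormSq u t x + (1 / 12) * ‖curl (u t) x‖ ^ 2 -
        (1 / 4) * ⟪curl (u t) x, e⟫ ^ 2 - devPressureHess p t x e) +
      (T - t) ^ 2 * (ν * strainLap u t x e) := by ring
  linarith

/-- **closer: door H⁺ is `GradientUniformDecay` (D_S) away from unconditional** —
`strainFeedingViscousDoor_of strainGrowthViscous_holds strainFrame_holds (strainThreshold_of hD strainThresholdLinear_holds)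
subcriticalStrainDoor_holds`. -/
theorem strainFeedingViscousDoor_of_decay (hD : GradientUniformDecay) : StrainFeedingViscousDoor :=
  strainFeedingViscousDoor_of strainGrowthViscous_holds strainFrame_holds
    (strainThreshold_of hD strainThresholdLinear_holds) subcriticalStrainDoor_holds

/-- **closer: door Π⁺ from D_S.** -/
theorem pressureFocusingViscousDoor_of_decay (hD : GradientUniformDecay) : PressureFocusingViscousDoor :=
  pressureFocusingViscousDoor_of poissonTrace_holds (strainFeedingViscousDoor_of_decay hD)

/-- **closer: door H from D_S** (E1_S is in the tree: `ArgmaxDoors.strainGrowth`, p658468). -/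
theorem strainFeedingDoor_of_decay (hD : GradientUniformDecay) : StrainFeedingDoor :=
  strainFeedingDoor_of_plates strainGrowth hD strainThresholdLinear_holds

/-- **closer: door Π from D_S.** -/
theorem pressureFocusingDoor_of_decay (hD : GradientUniformDecay) : PressureFocusingDoor :=
  pressureFocusingDoor_of_plates strainGrowth hD strainThresholdLinear_holds

#print axioms strainGrowthViscous_holds

/-! ## §9⁺ Doors H⁺ / Π⁺ CLOSED (D_S landed: sfl p659680 `ArgmaxDoors.gradientUniformDecay`) -/


/-- **door S37-H⁺ «StrainFeedingViscousDoor» CLOSED — unconditional regularity criterion.** -/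
theorem strainFeedingViscousDoor_holds : StrainFeedingViscousDoor :=
  strainFeedingViscousDoor_of_decay gradientUniformDecay_holds

/-- **door S37-Π⁺ «PressureFocusingViscousDoor» CLOSED — unconditional regularity criterion.** -/
theorem pressureFocusingViscousDoor_holds : PressureFocusingViscousDoor :=
  pressureFocusingViscousDoor_of_decay gradientUniformDecay_holds


#print axioms strainFeedingViscousDoor_holds
#print axioms pressureFocusingViscousDoor_holds

end Summit.NavierStokesRegularity.NavierStokesRegularity.Theorems.StrainDoors

end
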